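import Literature.Computability.Complexity.FinitePatching
import Literature.Computability.Complexity.FPStringBricks
import Literature.Computability.Complexity.MajorityEnumeration
import HarnessLib

/-!
# Functions of a bounded prefix are polynomial time; fixed-width numerals

Two small additions to the `FP` toolkit of the tree, used by the `Σ₂ᵖ` verifier of Meyer's
theorem (`MeyerVerifier.lean`) and by the clocked simulation behind it:

* `prefixFn_mem_FP` — **every string function that only depends on the first `B` symbols of its
  argument is in `FP`**: `w ↦ f (w.take B)` for an *arbitrary* `f : List Bool → List Bool` and a
  constant `B`. This is a twelve-line corollary of the tree's finite-patching lemma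
  `mem_FP_of_eqOn_le` (`FinitePatching.lean`: hardwire the values on the finitely many short
  inputs; Arora–Barak 2009, §1.3, "a constant-size table look-up") and the truncation brick
  `truncSndFn` (`CoinTruncation.lean`, as in `FPStringBricks.take1Fn_mem_FP`): `w ↦ w.take B` is in
  `FP`, and `v ↦ f v` patched to `ε` above length `B` is a finite patch of a constant. So finite
  functions — of decoded block values, of evidence bits — cost nothing, with no transducer written.
* `flattenFn_mem_FP` — the concatenation of the outputs of a list of `FP` functions is in `FP`.
* fixed-width numerals: `takeD_eq_natBits` — padding/truncating ANY numeral `c` to width `D`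
  (`List.takeD D c false`, the first component of `StackBricksStrings.padTakeFn ⟨1ᴰ, c⟩`) gives the
  width-`D` little-endian representation `natBits D ⟦c⟧` (`StackUnaryBits.natBits`; value
  `⟦c⟧ mod 2ᴰ`, `CoinEnum.bitsToNat_natBits_mod`) of its value — the normal form by which the
  verifier writes row and block indices into its queries. (That a word of length `D` is `natBits D`
  of its own value is `CoinEnum.natBits_bitsToNat` / `CoinEnum.eq_natBits_of_length`,
  `MajorityEnumeration.lean`; injectivity of `bitsToNat` at fixed length is
  `Kannan.eq_of_bitsToNat_eq`, `KannanLanguage.lean`.)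

## References

* S. Arora, B. Barak, *Computational Complexity: A Modern Approach*, CUP 2009, §1.3 (robustness of
  polynomial time; table look-up), proof of Thm. 6.6 (constant-size encodings of snapshots).
-/

namespace Literature.Computability.Complexity

open _root_.Computability

/-! ### Functions of a bounded prefix -/

/-- **Taking a constant-length prefix is in `FP`**: `w ↦ w.take B` is
`sndP ∘ truncSndFn (C B) ∘ ⟨ε, ·⟩` (the pattern of `FPStringBricks.take1Fn_mem_FP`).
[cite: AroraBarakCC2009, §1.3] -/
theorem takeConst_mem_FP (B : ℕ) : (fun w : List Bool => w.take B) ∈ FP := by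
  have h : (fun w : List Bool => w.take B) =
      sndP ∘ truncSndFn (Polynomial.C B) ∘ fanoutFn (fun _ => []) id := by
    funext w; simp [fanoutFn_apply, truncSndFn_boolPair, sndP]
  rw [h]
  exact comp_mem_FP sndP_mem_FP (comp_mem_FP (truncSndFn_mem_FP _)
    (fanoutFn_mem_FP (const_mem_FP _) OracleCompose.id_mem_FP))

/-- **Functions of a bounded prefix are in `FP`**: for every `B` and every string function `f`,
`w ↦ f (w.take B)` is polynomial-time computable — `f` patched to `ε` on inputs longer than `B` is
a finite patch of the constant `ε` (`mem_FP_of_eqOn_le`, `FinitePatching.lean`), composed with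
`w ↦ w.take B`. In particular every function that is applied only to arguments of length `≤ B`
agrees there with an `FP` function ("a constant-size table look-up", Arora–Barak 2009, §1.3,
proof of Thm. 6.6). [cite: AroraBarakCC2009, §1.3] -/
theorem prefixFn_mem_FP (B : ℕ) (f : List Bool → List Bool) : (fun w => f (w.take B)) ∈ FP := by
  classical
  have hg : (fun v : List Bool => if v.length ≤ B then f v else []) ∈ FP :=
    mem_FP_of_eqOn_le (const_mem_FP []) (B + 1) fun z hz => if_neg (by omega)
  have h := comp_mem_FP hg (takeConst_mem_FP B)
  have e : ((fun v : List Bool => if v.length ≤ B then f v else []) ∘ fun w : List Bool => w.take B) =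
      fun w => f (w.take B) := by
    funext w
    simp only [Function.comp_apply]
    rw [if_pos (by simp)]
  rwa [e] at h

/-- A function applied to arguments known to be short is computed by an `FP` function there:
if `|w| ≤ B` then `f w = (fun w => f (w.take B)) w`. [folklore] -/
theorem prefixFn_apply_of_length_le {B : ℕ} (f : List Bool → List Bool) {w : List Bool}
    (hw : w.length ≤ B) : (fun w => f (w.take B)) w = f w := by
  simp [List.take_of_length_le hw]

/-! ### Concatenating the outputs of a list of `FP` functions -/

/-- The concatenation of the outputs of a list of string functions. [folklore] -/
def flattenFn (fs : List (List Bool → List Bool)) (w : List Bool) : List Bool :=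
  (fs.map fun f => f w).flatten

/-- `flattenFn [] = ε`. [folklore] -/
@[simp] theorem flattenFn_nil (w : List Bool) : flattenFn [] w = [] := rfl

/-- `flattenFn (f :: fs) w = f w ++ flattenFn fs w`. [folklore] -/
@[simp] theorem flattenFn_cons (f : List Bool → List Bool) (fs : List (List Bool → List Bool))
    (w : List Bool) : flattenFn (f :: fs) w = f w ++ flattenFn fs w := rfl

/-- `flattenFn` of a concatenation of function lists. [folklore] -/
theorem flattenFn_append (fs gs : List (List Bool → List Bool)) (w : List Bool) :
    flattenFn (fs ++ gs) w = flattenFn fs w ++ flattenFn gs w := by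
  simp [flattenFn]

/-- **The concatenation of finitely many `FP` functions is in `FP`** (`append_mem_FP` iterated).
[cite: AroraBarakCC2009, §1.3] -/
theorem flattenFn_mem_FP {fs : List (List Bool → List Bool)} (h : ∀ f ∈ fs, f ∈ FP) :
    flattenFn fs ∈ FP := by
  induction fs with
  | nil => exact const_mem_FP []
  | cons f fs ih =>
    have e : flattenFn (f :: fs) = fun w => f w ++ flattenFn fs w := funext fun w => rfl
    rw [e]
    exact append_mem_FP (h f (by simp)) (ih fun g hg => h g (by simp [hg]))

/-! ### Fixed-width numerals -/

/-- The width-`D + 1` representation of `b + 2v` is `b` followed by the width-`D`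
representation of `v`. [folklore] -/
theorem natBits_succ_bit (D : ℕ) (b : Bool) (v : ℕ) :
    natBits (D + 1) (b.toNat + 2 * v) = b :: natBits D v := by
  rw [natBits]
  have h1 : (b.toNat + 2 * v) % 2 = b.toNat := by cases b <;> simp [Nat.add_mod]
  have h2 : (b.toNat + 2 * v) / 2 = v := by cases b <;> simp [Nat.add_mul_div_left]
  rw [h1, h2]
  cases b <;> rfl

/-- **Fixed-width normal form**: padding/truncating any numeral `c` to width `D` gives the
width-`D` representation of its value, `takeD D c 0… = natBits D ⟦c⟧` (whose value is
`⟦c⟧ mod 2ᴰ`, `CoinEnum.bitsToNat_natBits_mod`; for `|c| = D` this is `c` itself,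
`CoinEnum.natBits_bitsToNat`). [folklore] -/
theorem takeD_eq_natBits : ∀ (D : ℕ) (c : List Bool), List.takeD D c false = natBits D (bitsToNat c)
  | 0, _ => rfl
  | D + 1, [] => by
    rw [List.takeD_succ, bitsToNat_nil, CoinEnum.natBits_zero, List.replicate_succ]
    simp [takeD_eq_natBits D [], CoinEnum.natBits_zero]
  | D + 1, b :: c => by
    rw [List.takeD_succ, bitsToNat_cons, natBits_succ_bit, List.head?_cons, Option.getD_some,
      List.tail_cons, takeD_eq_natBits D c]

end Literature.Computability.Complexity
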